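import Literature.NumberTheory.EllipticCurves.HeckeTraceEllipticPart
import Literature.NumberTheory.EllipticCurves.HeckeOnManinSymbolsTrace
import Literature.NumberTheory.EllipticCurves.PopaZagierCosetSums
import Literature.NumberTheory.Automorphic.HeckeTraceFormulaGL2LevelPrimeDifference
import Literature.NumberTheory.Automorphic.HeckeTraceFormulaGL2LevelDimensionProofs
import Literature.NumberTheory.EllipticCurves.ModularCurveCuspsProofs
import Literature.NumberTheory.EllipticCurves.ModularCurveGamma0IndexProofs
import HarnessLib

/-!
# The Eichler–Selberg trace formula on `S₂(Γ₀(N))`, `N` squarefree, `(n, N) = 1`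

[Proofs] Theorems only.  We prove

  `Tr(T_n | S₂(Γ₀(N))) = A₁ + A₂ + A₃ + A₄`  (`cuspidalHeckeTrace N 2 𝟙 n = geometricSide N 𝟙 2 n`)

for squarefree `N` and `(n, N) = 1` (`cuspidalHeckeTrace_eq_geometricSide`), the right-hand side
being the geometric side of R. Schoof–M. van der Vlugt, JCTA 57 (1991), Thm. 2.2 (Cohen–Oesterlé's
form of the Eichler–Selberg trace formula) vendored in `HeckeTraceFormulaGL2Level`.  The proof is
Popa's ([Popa2014, §2], with the explicit Hecke element `T̃_n` of [PopaZagier2017, §4]) through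
modular symbols: `2 Tr(T_n) = tr(T̃_n | ℚ[X_N]) − ½ ∑ c(M) − σ₁(n)(ν_∞ − 1)`
(`two_mul_cuspidalHeckeTrace_eq`), `∑ c(M) = −2σ₁(n)` (`finsum_coeffN`), and
`tr(T̃_n | ℚ[X_N]) = ∑_M c(M) Fix_N(M)` evaluated through the form (12) of `T̃_n`
(`finsum_coeffN_mul_eq`) by the split/scalar classes (`finsum_bw_wH_fixCount`) and the elliptic
classes (`finsum_bw_wE_fixCount`); the resulting closed form is matched term by term with
`A₁, …, A₄` (`identityTerm_one_two_of_coprime`, the local densities `localDensity_one_squarefree`,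
`hyperbolicTerm_one_two_squarefree`, `parabolicTerm_one_two_of_coprime`).

## References
* [SchoofVandervlugt1991] R. Schoof, M. van der Vlugt, J. Combin. Theory A 57 (1991), Thm. 2.2.
* [Popa2014] A. Popa, Res. Math. Sci. 5 (2018), §2, Thm. 1.
* [PopaZagier2017] A. Popa, D. Zagier, arXiv:1711.00327, §4, Thm. 4.
-/

noncomputable section

open scoped MatrixGroups ModularForm Classical ArithmeticFunction.sigma
open CongruenceSubgroup ArithmeticFunction
open Literature.NumberTheory.Automorphic.PopaZagier
open Literature.NumberTheory.Automorphic.HeckeTraceFormulaGL2Level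

namespace Literature.NumberTheory.EllipticCurves.ModularForms

/-! ### Local densities at squarefree level -/

section LocalDensity

/-- The lifting of roots at `ℓ = 2`: for `2 ∣ f`, `f² ∣ t² − 4n`, `(t² − 4n)/f² ≡ 0, 1 (mod 4)`
and `n` odd, every root of `x² − t x + n` modulo `2` is a root modulo `4`.
[cite: SchoofVandervlugt1991, Thm. 2.2 (definition of μ), p. 168] -/
theorem four_dvd_quadratic {t : ℤ} {f n : ℕ} (hf : f ∈ ellipticConductors t n) (h2f : 2 ∣ f)
    (hn : n % 2 = 1) {x : ℤ} (hx : (2 : ℤ) ∣ x ^ 2 - t * x + n) : (4 : ℤ) ∣ x ^ 2 - t * x + n := by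
  obtain ⟨-, hsq, hq4⟩ := Finset.mem_filter.mp hf
  obtain ⟨f', rfl⟩ := h2f
  obtain ⟨q, hq⟩ := hsq
  -- `q = (t² - 4n)/f²` and `q % 4 ∈ {0, 1}`
  have hqdiv : (t ^ 2 - 4 * n) / ((2 * f' : ℕ) : ℤ) ^ 2 = q ∨ ((2 * f' : ℕ) : ℤ) = 0 := by
    by_cases h0 : ((2 * f' : ℕ) : ℤ) = 0
    · exact Or.inr h0
    · left; rw [hq, Int.mul_ediv_cancel_left _ (pow_ne_zero 2 h0)]
  -- `t` is even
  have ht2 : (2 : ℤ) ∣ t := by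
    have : (2 : ℤ) ∣ t ^ 2 := by
      refine ⟨2 * ((f' : ℤ) ^ 2 * q) + 2 * n, ?_⟩
      have : t ^ 2 = ((2 * f' : ℕ) : ℤ) ^ 2 * q + 4 * n := by linarith
      rw [this]; push_cast; ring
    exact Int.prime_two.dvd_of_dvd_pow this
  obtain ⟨t', rfl⟩ := ht2
  -- `t'² = f'² q + n`
  have hrel : t' ^ 2 = (f' : ℤ) ^ 2 * q + n := by
    have : (2 * t') ^ 2 - 4 * (n : ℤ) = ((2 * f' : ℕ) : ℤ) ^ 2 * q := hq
    push_cast at this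
    linarith
  -- `q % 4 ∈ {0,1}` unless `f' = 0` (then `t'² = n`)
  rcases Int.even_or_odd x with ⟨y, rfl⟩ | ⟨y, rfl⟩
  · -- `x` even: `Q(x)` is odd, contradiction
    exfalso
    obtain ⟨k, hk⟩ := hx
    have hn' : (n : ℤ) % 2 = 1 := by exact_mod_cast hn
    have e : (y + y) ^ 2 - 2 * t' * (y + y) + (n : ℤ) = 2 * (2 * y ^ 2 - 2 * t' * y) + n := by ring
    rw [e] at hk
    set C := 2 * y ^ 2 - 2 * t' * y
    omega
  · -- `x = 2y + 1`
    rcases Int.even_or_odd t' with ⟨s, rfl⟩ | ⟨s, rfl⟩ <;>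
      rcases Int.even_or_odd (f' : ℤ) with ⟨g, hg⟩ | ⟨g, hg⟩
    · -- t' even, f' even: `n = t'² - f'² q ≡ 0 (mod 4)`, contradicting `n` odd
      exfalso
      have : (n : ℤ) = (s + s) ^ 2 - (g + g) ^ 2 * q := by rw [← hg]; linarith
      have hn' : (n : ℤ) % 2 = 1 := by exact_mod_cast hn
      have : (n : ℤ) = 4 * (s ^ 2 - g ^ 2 * q) := by rw [this]; ring
      omega
    · -- t' even, f' odd: `q ≡ t'² - n`, so `n ≡ -q (mod 4)`, `q ∈ {0,1}` ⇒ `n ≡ 0, 3`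
      have hq' : q % 4 = 0 ∨ q % 4 = 1 := by
        rcases hqdiv with h | h
        · rw [h] at hq4; exact hq4
        · exfalso
          have : ((2 * f' : ℕ) : ℤ) = 2 * (2 * g + 1) := by push_cast; rw [hg]
          omega
      have e1 : (n : ℤ) = 4 * (s ^ 2 - (g ^ 2 + g) * q) - q := by
        have : (n : ℤ) = (s + s) ^ 2 - (2 * g + 1) ^ 2 * q := by rw [← hg]; linarith
        rw [this]; ring
      have e2 : (2 * y + 1) ^ 2 - 2 * (s + s) * (2 * y + 1) + (n : ℤ) =
          4 * (y ^ 2 + y - 2 * s * y - s) + 1 + n := by ring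
      rw [e2]
      set A := s ^ 2 - (g ^ 2 + g) * q
      set B := y ^ 2 + y - 2 * s * y - s
      have hn' : (n : ℤ) % 2 = 1 := by exact_mod_cast hn
      omega
    · -- t' odd, f' even
      have e1 : (n : ℤ) = 4 * (s ^ 2 + s - g ^ 2 * q) + 1 := by
        have : (n : ℤ) = (2 * s + 1) ^ 2 - (g + g) ^ 2 * q := by rw [← hg]; linarith
        rw [this]; ring
      have e2 : (2 * y + 1) ^ 2 - 2 * (2 * s + 1) * (2 * y + 1) + (n : ℤ) =
          4 * (y ^ 2 - 2 * s * y - s) - 1 + n := by ring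
      rw [e2]
      set A := s ^ 2 + s - g ^ 2 * q
      set B := y ^ 2 - 2 * s * y - s
      omega
    · -- t' odd, f' odd
      have hq' : q % 4 = 0 ∨ q % 4 = 1 := by
        rcases hqdiv with h | h
        · rw [h] at hq4; exact hq4
        · exfalso
          have : ((2 * f' : ℕ) : ℤ) = 2 * (2 * g + 1) := by push_cast; rw [hg]
          omega
      have e1 : (n : ℤ) = 4 * (s ^ 2 + s - (g ^ 2 + g) * q) + 1 - q := by
        have : (n : ℤ) = (2 * s + 1) ^ 2 - (2 * g + 1) ^ 2 * q := by rw [← hg]; linarith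
        rw [this]; ring
      have e2 : (2 * y + 1) ^ 2 - 2 * (2 * s + 1) * (2 * y + 1) + (n : ℤ) =
          4 * (y ^ 2 - 2 * s * y - s) - 1 + n := by ring
      rw [e2]
      set A := s ^ 2 + s - (g ^ 2 + g) * q
      set B := y ^ 2 - 2 * s * y - s
      have hn' : (n : ℤ) % 2 = 1 := by exact_mod_cast hn
      omega

/-- The lifting of roots at an odd prime `ℓ ∣ f`, `f² ∣ t² − 4n`: a root of `x² − t x + n`
modulo `ℓ` is a root modulo `ℓ²` (`ℓ ∣ 2x − t`). [cite: SchoofVandervlugt1991, Thm. 2.2 (definition of μ), p. 168] -/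
theorem sq_dvd_quadratic_of_odd {ℓ : ℕ} (hℓ : ℓ.Prime) (hodd : ℓ ≠ 2) {t : ℤ} {f n : ℕ}
    (hf : (f : ℤ) ^ 2 ∣ t ^ 2 - 4 * n) (hℓf : ℓ ∣ f) {x : ℤ} (hx : (ℓ : ℤ) ∣ x ^ 2 - t * x + n) :
    (ℓ : ℤ) ^ 2 ∣ x ^ 2 - t * x + n := by
  have hp : Prime (ℓ : ℤ) := Nat.prime_iff_prime_int.mp hℓ
  have hD : (ℓ : ℤ) ^ 2 ∣ t ^ 2 - 4 * n :=
    dvd_trans (pow_dvd_pow_of_dvd (Int.natCast_dvd_natCast.mpr hℓf) 2) hf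
  have e : (2 * x - t) ^ 2 = 4 * (x ^ 2 - t * x + n) + (t ^ 2 - 4 * n) := by ring
  have h1 : (ℓ : ℤ) ∣ (2 * x - t) ^ 2 := by
    rw [e]; exact dvd_add (hx.mul_left 4) (dvd_trans (dvd_pow_self _ two_ne_zero) hD)
  have h2 : (ℓ : ℤ) ^ 2 ∣ (2 * x - t) ^ 2 := pow_dvd_pow_of_dvd (hp.dvd_of_dvd_pow h1) 2
  have h3 : (ℓ : ℤ) ^ 2 ∣ 4 * (x ^ 2 - t * x + n) := by
    have : 4 * (x ^ 2 - t * x + n) = (2 * x - t) ^ 2 - (t ^ 2 - 4 * n) := by ring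
    rw [this]; exact dvd_sub h2 hD
  have hcop : IsCoprime ((ℓ : ℤ) ^ 2) 4 := by
    have h : Nat.Coprime (ℓ ^ 2) (2 ^ 2) :=
      Nat.Coprime.pow 2 2 ((Nat.coprime_primes hℓ Nat.prime_two).mpr hodd)
    have := Nat.isCoprime_iff_coprime.mpr h
    push_cast at this
    exact this
  exact hcop.dvd_of_dvd_mul_left h3

/-- Roots and divisibility: `ℓ ∣ x̃² − t x̃ + n` iff `x` is a root of `X² − tX + n` in `ℤ/ℓℤ`. [folklore] -/
theorem dvd_quadratic_val_iff {ℓ : ℕ} [NeZero ℓ] (t : ℤ) (n : ℕ) (x : ZMod ℓ) :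
    (ℓ : ℤ) ∣ (x.val : ℤ) ^ 2 - t * x.val + n ↔ x ^ 2 - (t : ZMod ℓ) * x + (n : ZMod ℓ) = 0 := by
  rw [← ZMod.intCast_zmod_eq_zero_iff_dvd]
  push_cast
  rw [ZMod.natCast_zmod_val]

/-- **The local density at a prime `ℓ`** (`(n, ℓ) = 1`, `f` a conductor): `μ_ℓ(t, f, n) = r_ℓ(t, n)`
if `ℓ ∤ f` and `(ℓ + 1) r_ℓ(t, n)` if `ℓ ∣ f` (then every root lifts modulo `ℓ²`).
[cite: SchoofVandervlugt1991, Thm. 2.2 (definition of μ), p. 168] -/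
theorem localDensity_one_prime {ℓ : ℕ} (hℓ : ℓ.Prime) {t : ℤ} {f n : ℕ} (hn : n.Coprime ℓ)
    (hf : f ∈ ellipticConductors t n) :
    localDensity ℓ 1 t f n =
      ((rootCount (ZMod ℓ) (t : ZMod ℓ) (n : ZMod ℓ) * (if ℓ ∣ f then ℓ + 1 else 1) : ℕ) : ℂ) := by
  haveI := Fact.mk hℓ
  have hsq := sq_dvd_of_mem_ellipticConductors hf
  rw [localDensity_one_eq_card]
  -- the unit root count equals the root count
  have hroot : ∀ x : ZMod ℓ, x ^ 2 - (t : ZMod ℓ) * x + (n : ZMod ℓ) = 0 → IsUnit x := by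
    intro x hx
    rw [isUnit_iff_ne_zero]
    rintro rfl
    simp only [ne_eq, OfNat.ofNat_ne_zero, not_false_eq_true, zero_pow, mul_zero, sub_zero,
      zero_add] at hx
    rw [ZMod.natCast_eq_zero_iff] at hx
    have := Nat.Coprime.eq_one_of_dvd (Nat.coprime_comm.mp hn) hx
    exact hℓ.ne_one this
  have hcount : (Finset.univ.filter fun x : ZMod ℓ =>
      ((ℓ * Nat.gcd ℓ f : ℕ) : ℤ) ∣ (x.val : ℤ) ^ 2 - t * x.val + n ∧ IsUnit x).card =
      rootCount (ZMod ℓ) (t : ZMod ℓ) (n : ZMod ℓ) := by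
    rw [rootCount_eq_card_filter]
    refine Finset.card_bij (fun x _ => x) (fun x hx => ?_) (fun _ _ _ _ h => h) (fun x hx => ⟨x, ?_, rfl⟩)
    · simp only [Finset.mem_filter, Finset.mem_univ, true_and] at hx ⊢
      refine (dvd_quadratic_val_iff t n x).mp (dvd_trans ?_ hx.1)
      exact Int.natCast_dvd_natCast.mpr (dvd_mul_right ℓ _)
    · simp only [Finset.mem_filter, Finset.mem_univ, true_and] at hx ⊢
      refine ⟨?_, hroot x hx⟩
      have h1 : (ℓ : ℤ) ∣ (x.val : ℤ) ^ 2 - t * x.val + n := (dvd_quadratic_val_iff t n x).mpr hx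
      by_cases hℓf : ℓ ∣ f
      · rw [Nat.gcd_eq_left hℓf]
        push_cast
        rw [← sq]
        by_cases h2 : ℓ = 2
        · subst h2
          norm_num
          exact four_dvd_quadratic hf hℓf (Nat.odd_iff.mp (Nat.coprime_two_right.mp hn)) h1
        · exact sq_dvd_quadratic_of_odd hℓ h2 hsq hℓf h1
      · rw [((Nat.Prime.coprime_iff_not_dvd hℓ).mpr hℓf).gcd_eq_one, mul_one]
        exact h1
  -- the prefactor
  have hpref : (dedekindPsi ℓ / dedekindPsi (ℓ / Nat.gcd ℓ f) : ℚ) = if ℓ ∣ f then (ℓ + 1 : ℚ) else 1 := by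
    by_cases hℓf : ℓ ∣ f
    · rw [if_pos hℓf, Nat.gcd_eq_left hℓf, Nat.div_self hℓ.pos, dedekindPsi_one, div_one,
        dedekindPsi_prime hℓ]
    · rw [if_neg hℓf, ((Nat.Prime.coprime_iff_not_dvd hℓ).mpr hℓf).gcd_eq_one, Nat.div_one,
        div_self (dedekindPsi_pos hℓ.ne_zero).ne']
  rw [hpref, hcount]
  push_cast
  split_ifs <;> push_cast <;> ring

/-- **Local densities at squarefree level** (`(n, N) = 1`, `f` a conductor):
`μ_N(t, f, n) = ∏_{ℓ ∣ N} r_ℓ(t, n) · ∏_{ℓ ∣ N, ℓ ∣ f} (ℓ + 1)` (multiplicativity in `N` and the prime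
case). [cite: SchoofVandervlugt1991, Thm. 2.2 (definition of μ), p. 168] -/
theorem localDensity_one_squarefree : ∀ {N : ℕ}, Squarefree N → ∀ {t : ℤ} {f n : ℕ},
    n.Coprime N → f ∈ ellipticConductors t n →
    localDensity N 1 t f n =
      (((∏ ℓ ∈ N.primeFactors, rootCount (ZMod ℓ) (t : ZMod ℓ) (n : ZMod ℓ)) *
        ∏ ℓ ∈ N.primeFactors, (if ℓ ∣ f then ℓ + 1 else 1) : ℕ) : ℂ) := by
  intro N
  induction N using Nat.recOnPosPrimePosCoprime with
  | zero => exact fun h => absurd h not_squarefree_zero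
  | one =>
    intro _ t f n _ _
    rw [Nat.primeFactors_one, Finset.prod_empty, Finset.prod_empty]
    unfold localDensity
    simp only [Nat.gcd_one_left, Nat.div_one, dedekindPsi_one, div_one, Rat.cast_one, one_mul,
      Finset.range_one, Finset.sum_singleton, Nat.cast_one, mul_one, Nat.cast_zero]
    rw [if_pos (one_dvd _), MulChar.one_apply (isUnit_of_subsingleton _)]
  | prime_pow p k hp hk =>
    intro hsqf t f n hn hf
    have hk1 : k = 1 := by
      rcases (Nat.squarefree_pow_iff hp.ne_one hk.ne').mp hsqf with ⟨-, h⟩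
      exact h
    subst hk1
    rw [pow_one] at hn ⊢
    rw [Nat.Prime.primeFactors hp, Finset.prod_singleton, Finset.prod_singleton]
    exact localDensity_one_prime hp hn hf
  | coprime m m' hm hm' hmm' ihm ihm' =>
    intro hsqf t f n hn hf
    haveI : NeZero m := ⟨by omega⟩
    haveI : NeZero m' := ⟨by omega⟩
    rw [localDensity_one_mul hmm' (sq_dvd_of_mem_ellipticConductors hf),
      ihm (Nat.squarefree_mul_iff.mp hsqf).2.1 (Nat.Coprime.coprime_dvd_right (dvd_mul_right m m') hn) hf,
      ihm' (Nat.squarefree_mul_iff.mp hsqf).2.2 (Nat.Coprime.coprime_dvd_right (dvd_mul_left m' m) hn) hf,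
      Nat.Coprime.primeFactors_mul hmm', Finset.prod_union hmm'.disjoint_primeFactors,
      Finset.prod_union hmm'.disjoint_primeFactors]
    push_cast
    ring

end LocalDensity

/-! ### The geometric side at squarefree level -/

section GeometricSide

variable {N : ℕ} [NeZero N]

omit [NeZero N] in
/-- **Elliptic term at squarefree level**, `(n, N) = 1`:
`A₂ = −½ ∑_{t² < 4n} ∑_f h_w((t² − 4n)/f²) · ∏_ℓ r_ℓ(t, n) ∏_{ℓ ∣ N, ℓ ∣ f} (ℓ + 1)`.
[cite: SchoofVandervlugt1991, Thm. 2.2 (A₂), p. 168] -/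
theorem ellipticTerm_one_two_squarefree (hN : Squarefree N) {n : ℕ} (hnN : n.Coprime N) :
    ellipticTerm N 1 2 n = -(1 / 2 : ℂ) * ∑ t ∈ tSet n, ∑ f ∈ ellipticConductors t n,
      (weightedClassNumber ((t ^ 2 - 4 * n) / (f : ℤ) ^ 2) : ℂ) *
        (((∏ ℓ ∈ N.primeFactors, rootCount (ZMod ℓ) (t : ZMod ℓ) (n : ZMod ℓ)) *
          ∏ ℓ ∈ N.primeFactors, (if ℓ ∣ f then ℓ + 1 else 1) : ℕ) : ℂ) := by
  unfold ellipticTerm tSet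
  congr 1
  refine Finset.sum_congr rfl fun t ht => ?_
  have ht2 : t ^ 2 < 4 * (n : ℤ) := (Finset.mem_filter.mp ht).2
  rw [archFactor_two (by exact_mod_cast ht2), one_mul]
  exact Finset.sum_congr rfl fun f hf => by rw [localDensity_one_squarefree hN hnN hf]

omit [NeZero N] in
/-- For squarefree `N` and `c ∣ N`: `gcd(c, N/c) = 1`. [folklore] -/
theorem gcd_div_eq_one_of_squarefree (hN : Squarefree N) {c : ℕ} (hc : c ∈ N.divisors) :
    Nat.gcd c (N / c) = 1 :=
  Nat.coprime_of_squarefree_mul (by rwa [Nat.mul_div_cancel' (Nat.dvd_of_mem_divisors hc)])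

/-- **Hyperbolic term at squarefree level**, `(n, N) = 1`: `A₃ = −τ(N) ∑'_{d ∣ n, d ≤ √n} d`.
[cite: SchoofVandervlugt1991, Thm. 2.2 (A₃), p. 168] -/
theorem hyperbolicTerm_one_two_squarefree (hN : Squarefree N) {n : ℕ} (hnN : n.Coprime N) :
    hyperbolicTerm N 1 2 n = -((N.divisors.card : ℂ) *
      ∑ d ∈ n.divisors.filter (fun d => d * d ≤ n), (if d * d = n then (1 / 2 : ℂ) else 1) * (d : ℂ)) := by
  rw [hyperbolicTerm_one_two_of_coprime N hnN, Finset.mul_sum]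
  congr 1
  refine Finset.sum_congr rfl fun d _ => ?_
  have hinner : (∑ c ∈ N.divisors.filter (fun c => (Nat.gcd c (N / c) : ℤ) ∣ ((n / d : ℕ) : ℤ) - d),
      (Nat.totient (Nat.gcd c (N / c)) : ℂ)) = (N.divisors.card : ℂ) := by
    rw [Finset.filter_true_of_mem fun c hc => by rw [gcd_div_eq_one_of_squarefree hN hc]; simp,
      Finset.card_eq_sum_ones, Nat.cast_sum]
    exact Finset.sum_congr rfl fun c hc => by
      rw [gcd_div_eq_one_of_squarefree hN hc, Nat.totient_one]
  rw [hinner]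
  ring

/-- `ν_∞(Γ₀(N)) = τ(N)` for squarefree `N`. [cite: ShimuraIATAF1971, Prop. 1.43] -/
theorem numCusps_squarefree (hN : Squarefree N) : numCusps N = N.divisors.card := by
  rw [show numCusps N = nuInfty N from numCusps_eq_nuInfty_holds N, nuInfty, Finset.card_eq_sum_ones]
  exact Finset.sum_congr rfl fun d hd => by rw [gcd_div_eq_one_of_squarefree hN hd, Nat.totient_one]

/-- `|SL₂(ℤ)/Γ₀(N)| = ψ(N)`. [cite: ShimuraIATAF1971, Prop. 1.43] -/
theorem natCard_gamma0Coset_eq_dedekindPsi (N : ℕ) [NeZero N] :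
    (Nat.card (Gamma0Coset N) : ℚ) = dedekindPsi N := by
  rw [dedekindPsi_eq_gamma0Index_cast, show Nat.card (Gamma0Coset N) = (Gamma0 N).index from rfl,
    show (Gamma0 N).index = gamma0Index N from index_gamma0_eq_gamma0Index_holds N]

/-- The divisor pairing `d ↔ n/d`:
`∑_{a ∣ n, a² < n} (n/a − a) − σ₁(n) = −2 ∑'_{d ∣ n, d² ≤ n} d` (`d = √n` weighted `½`). [folklore] -/
theorem sum_divisors_pairing {n : ℕ} (hn : 0 < n) :
    (∑ a ∈ n.divisors.filter (fun a => a * a < n), (((n / a : ℕ) : ℚ) - a)) - ((σ 1 n : ℕ) : ℚ) =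
      -2 * ∑ d ∈ n.divisors.filter (fun d => d * d ≤ n), (if d * d = n then (1 / 2 : ℚ) else 1) * d := by
  have hσ : ((σ 1 n : ℕ) : ℚ) = ∑ d ∈ n.divisors, (d : ℚ) := by
    rw [sigma_one_apply, Nat.cast_sum]
  -- trichotomy of a divisor
  have htri : ∑ d ∈ n.divisors, (d : ℚ) = ∑ d ∈ n.divisors,
      ((if d * d < n then (d : ℚ) else 0) + (if d * d = n then (d : ℚ) else 0) +
        (if n < d * d then (d : ℚ) else 0)) := by
    refine Finset.sum_congr rfl fun d _ => ?_
    rcases lt_trichotomy (d * d) n with h | h | h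
    · rw [if_pos h, if_neg h.ne, if_neg (not_lt.mpr h.le)]; ring
    · rw [if_neg (by omega), if_pos h, if_neg (by omega)]; ring
    · rw [if_neg (not_lt.mpr h.le), if_neg h.ne', if_pos h]; ring
  -- the large divisors are the `n/d`, `d` small
  have hswap : ∑ d ∈ n.divisors, (if n < d * d then (d : ℚ) else 0) =
      ∑ d ∈ n.divisors, (if d * d < n then ((n / d : ℕ) : ℚ) else 0) := by
    rw [← Nat.sum_div_divisors n (fun d => if n < d * d then (d : ℚ) else 0)]
    refine Finset.sum_congr rfl fun d hd => ?_
    have hdn : d ∣ n := Nat.dvd_of_mem_divisors hd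
    obtain ⟨e, he⟩ := hdn
    have hd0 : 0 < d := Nat.pos_of_mem_divisors hd
    have hediv : n / d = e := by rw [he, Nat.mul_div_cancel_left _ hd0]
    rw [hediv]
    have hiff : n < e * e ↔ d * d < n := by
      subst he
      constructor <;> intro h <;> nlinarith
    by_cases h : d * d < n
    · rw [if_pos (hiff.mpr h), if_pos h]
    · rw [if_neg (fun h' => h (hiff.mp h')), if_neg h]
  rw [hσ, htri, Finset.sum_add_distrib, Finset.sum_add_distrib, hswap, Finset.sum_filter,
    Finset.sum_filter, Finset.mul_sum, ← Finset.sum_add_distrib, ← Finset.sum_add_distrib,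
    ← Finset.sum_sub_distrib]
  refine Finset.sum_congr rfl fun d _ => ?_
  rcases lt_trichotomy (d * d) n with h | h | h
  · rw [if_pos h, if_pos h, if_neg h.ne, if_pos h, if_pos h.le, if_neg h.ne]; ring
  · rw [if_neg (by omega), if_neg (by omega), if_pos h, if_neg (by omega), if_pos h.le, if_pos h]; ring
  · rw [if_neg (not_lt.mpr h.le), if_neg (not_lt.mpr h.le), if_neg h.ne', if_neg (not_lt.mpr h.le),
      if_neg (not_le.mpr h)]; ring

end GeometricSide

/-! ### The trace formula -/

section Main

variable {N : ℕ} [NeZero N]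

/-- The fixed-point count of `HeckeOnManinSymbolsTrace` is `fixCount`. [folklore] -/
theorem card_filter_actP_eq_fixCount (M : Matrix (Fin 2) (Fin 2) ℤ) :
    (Finset.univ.filter fun q : Gamma0Coset N => actP N q (Matrix.adjugate M) = q).card = fixCount N M := by
  rw [fixCount, Nat.card_eq_fintype_card, Fintype.card_subtype]

/-- **The Eichler–Selberg trace formula for `T_n` on `S₂(Γ₀(N))`, `N` squarefree, `(n, N) = 1`**
(Schoof–van der Vlugt, Thm. 2.2, weight `2`, trivial character), proved through Popa's
modular-symbol approach with the Popa–Zagier Hecke element.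
[cite: SchoofVandervlugt1991, Thm. 2.2; Popa2014, §2, Thm. 1; PopaZagier2017, Thm. 4] -/
theorem cuspidalHeckeTrace_eq_geometricSide (hN : Squarefree N) {n : ℕ} (hn : 0 < n)
    (hnN : n.Coprime N) : cuspidalHeckeTrace N 2 1 n = geometricSide N 1 2 n := by
  -- Popa's identity on M-symbols for `ξ = c_n`
  set s : Finset (Matrix (Fin 2) (Fin 2) ℤ) := (finite_support_coeffN (n : ℤ)).toFinset with hs_def
  have hs : Function.support (coeffN (n : ℤ)) ⊆ (s : Set _) := fun M hM => by
    rw [Finset.mem_coe, hs_def, Set.Finite.mem_toFinset]; exact hM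
  have hMI := two_mul_cuspidalHeckeTrace_eq hN hn hnN (heckeHyp_coeffN (n : ℤ))
    (fun M hM => orbT_zeta0_coeffN_eq (by exact_mod_cast hn) hM) hs
  -- `∑ c(M) = -2σ₁`
  have hS2 : ∑ M ∈ s, coeffN (n : ℤ) M = -2 * ((n.divisors.sum id : ℕ) : ℚ) := by
    rw [← finsum_eq_sum_of_support_subset _ hs]; exact finsum_coeffN hn
  -- `∑ c(M) Fix(M) = (1/6)(H - E)`
  have hS1 : ∑ M ∈ s, coeffN (n : ℤ) M *
      ((Finset.univ.filter fun q : Gamma0Coset N => actP N q (Matrix.adjugate M) = q).card : ℚ) =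
      ∑ᶠ M, coeffN (n : ℤ) M * (fixCount N M : ℚ) := by
    rw [finsum_eq_sum_of_support_subset (fun M => coeffN (n : ℤ) M * (fixCount N M : ℚ)) (s := s)
      fun M hM => hs (Function.support_mul_subset_left _ _ hM)]
    exact Finset.sum_congr rfl fun M _ => by rw [card_filter_actP_eq_fixCount]
  have hCF : ∑ᶠ M, coeffN (n : ℤ) M * (fixCount N M : ℚ) =
      (1 / 6 : ℚ) * ((∑ᶠ M, bw wH n M * (fixCount N M : ℚ)) - ∑ᶠ M, bw wE n M * (fixCount N M : ℚ)) :=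
    finsum_coeffN_mul_eq (fun M => (fixCount N M : ℚ)) (fun M => by exact_mod_cast fixCount_neg N M)
      (fun M => by exact_mod_cast fixCount_conjS N M) (fun M => by exact_mod_cast fixCount_conjU N M)
  have hH := finsum_bw_wH_fixCount hN hn hnN
  have hE := finsum_bw_wE_fixCount hN hn hnN
  -- arithmetic of the level
  have hν : (Nat.card (CuspOrbits (Gamma0 N : Subgroup (GL (Fin 2) ℝ))) : ℚ) = N.divisors.card := by
    exact_mod_cast numCusps_squarefree hN
  have h2ω : (2 ^ N.primeFactors.card : ℚ) = N.divisors.card := by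
    exact_mod_cast (card_divisors_of_squarefree hN).symm
  have hX : (Nat.card (Gamma0Coset N) : ℚ) = dedekindPsi N := natCard_gamma0Coset_eq_dedekindPsi N
  have hσ : ((n.divisors.sum id : ℕ) : ℚ) = ((σ 1 n : ℕ) : ℚ) := by rw [sigma_one_apply]; rfl
  have hL8 := sum_divisors_pairing hn
  -- the rational quantities on the geometric side
  set Wq : ℚ := ∑ t ∈ tSet n, ∑ f ∈ ellipticConductors t n,
    weightedClassNumber ((t ^ 2 - 4 * n) / (f : ℤ) ^ 2) *
      (((∏ ℓ ∈ N.primeFactors, rootCount (ZMod ℓ) (t : ZMod ℓ) (n : ZMod ℓ)) *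
        ∏ ℓ ∈ N.primeFactors, (if ℓ ∣ f then ℓ + 1 else 1) : ℕ) : ℚ) with hWq
  set Dq : ℚ := ∑ d ∈ n.divisors.filter (fun d => d * d ≤ n), (if d * d = n then (1 / 2 : ℚ) else 1) * d
    with hDq
  set Pq : ℚ := ∑ a ∈ n.divisors.filter (fun a => a * a < n), (((n / a : ℕ) : ℚ) - a) with hPq
  have hEW : ∑ᶠ M, bw wE n M * (fixCount N M : ℚ) = 12 * Wq := by
    rw [hE, hWq]
    congr 1
    refine Finset.sum_congr rfl fun t _ => ?_
    rw [Finset.mul_sum]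
    refine Finset.sum_congr rfl fun f _ => ?_
    push_cast
    ring
  -- the geometric side as a rational number
  have c1 : identityTerm N 1 2 n = (((if IsSquare n then dedekindPsi N / 12 else 0 : ℚ)) : ℂ) := by
    rw [identityTerm_one_two_of_coprime hnN]
    split_ifs <;> push_cast <;> ring
  have c2 : ellipticTerm N 1 2 n = ((-(1 / 2) * Wq : ℚ) : ℂ) := by
    rw [ellipticTerm_one_two_squarefree hN hnN, hWq]
    simp only [Rat.cast_mul, Rat.cast_neg, Rat.cast_sum, Rat.cast_natCast, Rat.cast_div, Rat.cast_one,
      Rat.cast_ofNat]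
  have c3 : hyperbolicTerm N 1 2 n = ((-(N.divisors.card * Dq) : ℚ) : ℂ) := by
    rw [hyperbolicTerm_one_two_squarefree hN hnN, hDq]
    simp only [Rat.cast_mul, Rat.cast_neg, Rat.cast_sum, Rat.cast_natCast, Rat.cast_div, Rat.cast_one,
      Rat.cast_ofNat, apply_ite (Rat.cast : ℚ → ℂ)]
  have c4 : parabolicTerm N 1 2 n = (((σ 1 n : ℕ) : ℚ) : ℂ) := by
    rw [parabolicTerm_one_two_of_coprime hnN, Rat.cast_natCast]
  have hgeom : geometricSide N 1 2 n =
      (((if IsSquare n then dedekindPsi N / 12 else 0 : ℚ) + -(1 / 2) * Wq + -(N.divisors.card * Dq) +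
        ((σ 1 n : ℕ) : ℚ) : ℚ) : ℂ) := by
    rw [geometricSide, c1, c2, c3, c4, ← Rat.cast_add, ← Rat.cast_add, ← Rat.cast_add]
  -- assemble
  apply mul_left_cancel₀ (two_ne_zero' ℂ)
  have e2 : ∀ q : ℚ, (2 : ℂ) * (q : ℂ) = ((2 * q : ℚ) : ℂ) := fun q => by push_cast; ring
  rw [hMI, hgeom, e2, Rat.cast_inj, hS1, hCF, hH, hEW, hS2, hν, h2ω, hX, hσ]
  by_cases hsq : IsSquare n
  · simp only [hsq, if_true]
    linear_combination (N.divisors.card : ℚ) * hL8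
  · simp only [hsq, if_false]
    linear_combination (N.divisors.card : ℚ) * hL8

end Main

end Literature.NumberTheory.EllipticCurves.ModularForms

end
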